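import Literature.Probability.Percolation.ChayesLeiHexProofs
import Literature.Probability.Percolation.TriRSWChaining
import HarnessLib

/-!
# Route CardyBondTriangular · crux `BondTriangularCardy` · line `birth`: blue annulus crossings from yellow ones by self-duality

Helper of the stub `stub_equicontinuity` (hypothesis (B), blue part, of the assembly
`equicontinuity_of_arms_of_annulusBounds`). For a SELF-DUAL Chayes–Lei hexagon model `M`
(`a = e`; Chayes–Lei, J. Stat. Phys. 122 (2006) Prop. 2.1: the model `(a, e, s)` is dual to
`(e, s, a)`, "the condition for self-duality is just `a = e`"; for critical bond percolation on
`𝕋`, `isSelfDual_triBondCritical`) the law of the BLUE structure is the law of the YELLOW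
structure after the point reflection `x ↦ -x` of the lattice of hexagons: colour reversal
`Y ↔ B` (split states fixed) composed with `x ↦ -x` maps the up-corners of the hexagon of `x`
to the down-corners of the hexagon of `-x`, hence the blue corners of every admissible state to
the yellow corners of an admissible state (Chayes–Lei, Rev. Math. Phys. 19 (2007) §2.1: the
three admissible splits have their yellow pole at a dual vertex, their blue pole at a site), so
it maps blue paths of hexagons to yellow paths of hexagons (`clYellowGraph_adj_neg_of_clBlueGraph_adj`)
and preserves `clHexPercolation M` (`map_clHexPercolation_dualReflect`). Consequently the
smallness of yellow annulus crossings (qualitative Lemma 4 of Bollobás–Riordan 2006, Ch. 7,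
p. 167) implies that of blue annulus crossings (`clBlueAnnulus_small_of_yellow`). The colour
reversal is carried as a function `rev` with its three defining equations (no definition is
introduced).

## References

* L. Chayes, H. K. Lei, J. Stat. Phys. 122 (2006) 647–670, §2.2 Prop. 2.1 (duality, `a = e`).
* L. Chayes, H. K. Lei, Rev. Math. Phys. 19 (2007) 511–565, §2.1–2.2.
* B. Bollobás, O. Riordan, *Percolation*, CUP (2006), Ch. 7, Lemma 4 p. 167 ("applies equally
  well to closed crossings").
-/

noncomputable section

namespace Summit.CriticalPhenomena.CardyFormulaZ2.Theorems

open MeasureTheory Set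
open Literature.Probability.Percolation Literature.Probability.LatticeModels

/-! ### Colour reversal and point reflection -/

/-- **Colour reversal turns blue up-corners into yellow down-corners**: if `rev` swaps the pure
states and fixes the split states, then `rev st` is yellow at the `k`-th down-corner iff `st` is
blue at the `k`-th up-corner (for a split state: the blue pole is the down-corner opposite the
yellow pole). -/
theorem yellowAt_rev_downCorner_iff {rev : CLHexState → CLHexState} (hY : rev .Y = .B) (hB : rev .B = .Y)
    (hs : ∀ j, rev (.split j) = .split j) (st : CLHexState) (x x' : Site 2) (k : Fin 3) :
    (rev st).yellowAt x' (downCorner x' k) ↔ ¬ st.yellowAt x (upCorner x k) := by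
  rcases st with _ | _ | j
  · rw [hY]; simp
  · rw [hB]; simp
  · rw [hs, CLHexState.yellowAt_split_downCorner, CLHexState.yellowAt_split_upCorner]

/-- Point reflection maps a common up-corner of two hexagons to a common down-corner of the
reflected hexagons. -/
theorem downCorner_neg_eq_of_upCorner_eq {x y : Site 2} {k k' : Fin 3} (h : upCorner x k = upCorner y k') :
    downCorner (-x) k = downCorner (-y) k' := by
  have h1 : x - triUnit k = y - triUnit k' := congrArg Prod.fst h
  simp only [downCorner, Prod.mk.injEq, and_true]
  have h2 : -x + triUnit k = -y + triUnit k' := by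
    have : -(x - triUnit k) = -(y - triUnit k') := by rw [h1]
    simpa [neg_sub, sub_eq_neg_add] using this
  rw [sub_add_eq_add_sub, sub_add_eq_add_sub, h2]

/-- **Blue adjacency is yellow adjacency of the colour-reversed, reflected configuration**: if
`τ (-t) = rev (σ t)` for all hexagons `t`, then two blue-adjacent hexagons of `σ` reflect to two
yellow-adjacent hexagons of `τ` (blue junctions sit at up-corners, `clBlueGraph_adj_iff_up`,
yellow ones at down-corners, `clYellowGraph_adj_iff_down`). -/
theorem clYellowGraph_adj_neg_of_clBlueGraph_adj {rev : CLHexState → CLHexState} (hY : rev .Y = .B)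
    (hB : rev .B = .Y) (hs : ∀ j, rev (.split j) = .split j) {σ τ : CLHexConfig}
    (hτ : ∀ t, τ (-t) = rev (σ t)) {x y : Site 2} (h : (clBlueGraph σ).Adj x y) :
    (clYellowGraph τ).Adj (-x) (-y) := by
  rw [clBlueGraph_adj_iff_up] at h
  obtain ⟨hadj, k, k', hkk', hx, hy⟩ := h
  rw [clYellowGraph_adj_iff_down]
  refine ⟨triGraph_adj_neg hadj, k', k, downCorner_neg_eq_of_upCorner_eq hkk', ?_, ?_⟩
  · rw [hτ, yellowAt_rev_downCorner_iff hY hB hs (σ x) x]; exact hx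
  · rw [hτ, yellowAt_rev_downCorner_iff hY hB hs (σ y) y]; exact hy

/-- Blue connectivity of `σ` is yellow connectivity of the colour-reversed, reflected
configuration. -/
theorem clYellowGraph_reachable_neg_of_clBlueGraph_reachable {rev : CLHexState → CLHexState} (hY : rev .Y = .B)
    (hB : rev .B = .Y) (hs : ∀ j, rev (.split j) = .split j) {σ τ : CLHexConfig}
    (hτ : ∀ t, τ (-t) = rev (σ t)) {x y : Site 2} (h : (clBlueGraph σ).Reachable x y) :
    (clYellowGraph τ).Reachable (-x) (-y) := by
  obtain ⟨W⟩ := h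
  induction W with
  | nil => rfl
  | cons hadj _ ih => exact (clYellowGraph_adj_neg_of_clBlueGraph_adj hY hB hs hτ hadj).reachable.trans ih

/-! ### The law is preserved -/

/-- For a self-dual model (`a = e`) the one-hexagon law is invariant under colour reversal. -/
theorem map_hexLaw_rev {rev : CLHexState → CLHexState} (hY : rev .Y = .B) (hB : rev .B = .Y)
    (hs : ∀ j, rev (.split j) = .split j) (M : ChayesLeiHexPercolation) (hM : M.IsSelfDual) :
    M.hexLaw.map rev = M.hexLaw := by
  have hrev : Measurable rev := measurable_of_countable rev
  haveI : IsProbabilityMeasure (M.hexLaw.map rev) := Measure.isProbabilityMeasure_map hrev.aemeasurable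
  have hinv : ∀ st, rev (rev st) = st := by
    intro st; rcases st with _ | _ | j
    · rw [hY, hB]
    · rw [hB, hY]
    · rw [hs, hs]
  refine Measure.ext_of_singleton fun st => ?_
  rw [Measure.map_apply hrev (MeasurableSet.singleton st)]
  have hpre : rev ⁻¹' {st} = {rev st} := by
    ext u
    simp only [Set.mem_preimage, Set.mem_singleton_iff]
    constructor
    · intro h; rw [← h, hinv]
    · intro h; rw [h, hinv]
  rw [hpre, ChayesLeiHexPercolation.hexLaw_singleton, ChayesLeiHexPercolation.hexLaw_singleton]
  have hM' : M.a = M.e := hM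
  rcases st with _ | _ | j
  · rw [hY]; simp [hM']
  · rw [hB]; simp [hM']
  · rw [hs]

/-- **Self-duality as a measure-preserving map**: for a self-dual Chayes–Lei model, colour
reversal composed with the point reflection of the lattice of hexagons preserves
`clHexPercolation M` (CL 2006 Prop. 2.1). -/
theorem map_clHexPercolation_dualReflect {rev : CLHexState → CLHexState} (hY : rev .Y = .B) (hB : rev .B = .Y)
    (hs : ∀ j, rev (.split j) = .split j) (M : ChayesLeiHexPercolation) (hM : M.IsSelfDual) :
    (clHexPercolation M).map (fun (σ : CLHexConfig) (t : Site 2) => rev (σ (-t))) = clHexPercolation M := by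
  have hrev : Measurable rev := measurable_of_countable rev
  have h1 : Measurable fun (σ : CLHexConfig) (t : Site 2) => σ (-t) :=
    measurable_pi_lambda _ fun t => measurable_pi_apply (-t)
  have h2 : Measurable fun (σ : CLHexConfig) (t : Site 2) => rev (σ t) :=
    measurable_pi_lambda _ fun t => hrev.comp (measurable_pi_apply t)
  have hcomp : (fun (σ : CLHexConfig) (t : Site 2) => rev (σ (-t))) =
      (fun (σ : CLHexConfig) (t : Site 2) => rev (σ t)) ∘ fun (σ : CLHexConfig) (t : Site 2) => σ (-t) := rfl
  rw [hcomp, ← Measure.map_map h2 h1]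
  unfold clHexPercolation
  rw [Measure.map_infinitePi_infinitePi_of_inj (P := fun _ : Site 2 => M.hexLaw) neg_injective,
    Measure.infinitePi_map_pi (μ := fun _ : Site 2 => M.hexLaw) (f := fun _ => rev) (fun _ => hrev),
    map_hexLaw_rev hY hB hs M hM]

/-! ### Blue annulus crossings -/

/-- **Blue annulus crossings of a self-dual Chayes–Lei model are as small as yellow ones**
(Bollobás–Riordan 2006, Ch. 7, p. 167: Lemma 4 "applies equally well to closed crossings", here
by the self-duality of CL 2006 Prop. 2.1 instead of the colour symmetry of site percolation): if
for every `ε > 0` there are `ρ > 0` and `C` such that a yellow path of hexagons of `δ𝕋` crosses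
an annulus of radii `C δ ≤ r₁ ≤ ρ r₂` with probability `≤ ε`, then the same holds for blue paths
of hexagons — the reflected configuration with reversed colours has the same law and its
yellow paths are the blue paths of the original one, while the reflected annulus is an annulus
with the same radii. -/
theorem clBlueAnnulus_small_of_yellow : ∀ (M : Literature.Probability.Percolation.ChayesLeiHexPercolation), M.IsSelfDual → (∀ ε > (0 : ℝ), ∃ ρ > (0 : ℝ), ∃ C > (0 : ℝ), ∀ (δ : ℝ) (z : ℂ) (r₁ r₂ : ℝ), 0 < δ → C * δ ≤ r₁ → r₁ ≤ ρ * r₂ → (Literature.Probability.Percolation.clHexPercolation M).real {σ | ∃ x y : Literature.Probability.LatticeModels.Site 2, (Literature.Probability.Percolation.clYellowGraph σ).Reachable x y ∧ ‖Literature.Probability.LatticeModels.triMeshPoint δ x - z‖ < r₁ ∧ r₂ < ‖Literature.Probability.LatticeModels.triMeshPoint δ y - z‖} ≤ ε) → ∀ ε > (0 : ℝ), ∃ ρ > (0 : ℝ), ∃ C > (0 : ℝ), ∀ (δ : ℝ) (z : ℂ) (r₁ r₂ : ℝ), 0 < δ → C * δ ≤ r₁ → r₁ ≤ ρ * r₂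 → (Literature.Probability.Percolation.clHexPercolation M).real {σ | ∃ x y : Literature.Probability.LatticeModels.Site 2, (Literature.Probability.Percolation.clBlueGraph σ).Reachable x y ∧ ‖Literature.Probability.LatticeModels.triMeshPoint δ x - z‖ < r₁ ∧ r₂ < ‖Literature.Probability.LatticeModels.triMeshPoint δ y - z‖} ≤ ε := by
  intro M hM hYs ε hε
  obtain ⟨ρ, hρ, C, hC, h⟩ := hYs ε hε
  refine ⟨ρ, hρ, C, hC, fun δ z r₁ r₂ hδ h1 h2 => ?_⟩
  -- the colour reversal
  obtain ⟨rev, hY, hB, hs⟩ : ∃ rev : CLHexState → CLHexState,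
      rev .Y = .B ∧ rev .B = .Y ∧ ∀ j, rev (.split j) = .split j :=
    ⟨fun st => match st with
      | .Y => .B
      | .B => .Y
      | .split j => .split j, rfl, rfl, fun _ => rfl⟩
  set Φ : CLHexConfig → CLHexConfig := fun σ t => rev (σ (-t)) with hΦ
  have hΦm : Measurable Φ :=
    measurable_pi_lambda _ fun t => (measurable_of_countable rev).comp (measurable_pi_apply (-t))
  set Yev : Set CLHexConfig := {σ | ∃ x y : Site 2, (clYellowGraph σ).Reachable x y ∧
      ‖triMeshPoint δ x - (-z)‖ < r₁ ∧ r₂ < ‖triMeshPoint δ y - (-z)‖} with hYev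
  -- blue crossings reflect to yellow crossings about `-z`
  have hsub : {σ : CLHexConfig | ∃ x y : Site 2, (clBlueGraph σ).Reachable x y ∧
      ‖triMeshPoint δ x - z‖ < r₁ ∧ r₂ < ‖triMeshPoint δ y - z‖} ⊆ Φ ⁻¹' Yev := by
    rintro σ ⟨x, y, hxy, hx, hy⟩
    have hneg : ∀ t : Site 2, ‖triMeshPoint δ (-t) - (-z)‖ = ‖triMeshPoint δ t - z‖ := fun t => by
      rw [triMeshPoint, triMeshPoint, triEmbed_neg,
        show (δ : ℂ) * -triEmbed t - -z = -((δ : ℂ) * triEmbed t - z) by ring, norm_neg]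
    refine ⟨-x, -y, ?_, by rw [hneg]; exact hx, by rw [hneg]; exact hy⟩
    exact clYellowGraph_reachable_neg_of_clBlueGraph_reachable hY hB hs (τ := Φ σ) (fun t => by simp [hΦ]) hxy
  have hmap : (clHexPercolation M).map Φ = clHexPercolation M := map_clHexPercolation_dualReflect hY hB hs M hM
  calc (clHexPercolation M).real {σ : CLHexConfig | ∃ x y : Site 2, (clBlueGraph σ).Reachable x y ∧
          ‖triMeshPoint δ x - z‖ < r₁ ∧ r₂ < ‖triMeshPoint δ y - z‖}
      ≤ (clHexPercolation M).real (Φ ⁻¹' Yev) := measureReal_mono hsub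
    _ ≤ ((clHexPercolation M).map Φ).real Yev := by
        simp only [measureReal_def]
        exact ENNReal.toReal_mono (measure_ne_top _ _) (Measure.le_map_apply hΦm.aemeasurable Yev)
    _ = (clHexPercolation M).real Yev := by rw [hmap]
    _ ≤ ε := h δ (-z) r₁ r₂ hδ h1 h2

end Summit.CriticalPhenomena.CardyFormulaZ2.Theorems

end
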